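import Mathlib
import Literature.Analysis.FluidPDE.VectorCalculus
import Summits.NavierStokesRegularity.NavierStokesRegularity.Theorems.ThreadingFluxErtelTowerStagnationGerms
import Summits.NavierStokesRegularity.NavierStokesRegularity.Theorems.ThreadingFluxErtelTowerEulerTower
import HarnessLib

/-!
# Crux `PoloidalLiouville` (stmt-NavierStokesRegularity-1222, W1), crux idea «radial-jerk-tower» (ns-idea-15 g7):
# CONE-TIP RIGIDITY AT A STAGNATION CENTRE OF A SMOOTH STEADY DRIFT

Support file (`--supports stmt-NavierStokesRegularity-1222`, helper).  Experiment cell `ns-wall-extremal`, width hand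
ns-wall-eng-5 g10, item (ε) E7b = second half of OPEN ITEM (i) of g9's record of custody (`HOME/ARM-B/shadow-eng5g9/README.md`:
«the SMOOTH (non-analytic) stagnation case: a cone-tip statement (B = 0 on the open set where |D_A(z)| beats the o(|z|³)
remainder)»); first half = `…ErtelTowerStagnationGerms` (E7a).  0 kit.  Theorem-only; nothing of the sketch
`Cruxes/PoloidalLiouville/ErtelTowerSketch.lean` is restated or closed.

E6b (`…ErtelTowerStagnationJetRigidity`) decides the inviscid shadow about a non-axisymmetric stagnation centre on the WHOLE domain
when the drift is REAL-ANALYTIC (identity theorem ⇒ `{D ≠ 0}` dense).  For a merely SMOOTH drift `{D ≠ 0}` need not be dense in any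
ball about `x₀`; what the 1-jet does control is a CONE TIP, by E7a's Fréchet germ `D = D_A + o(‖·‖³)` (`isLittleO_disc_stagnation`):

* `eventually_ne_zero_of_isLittleO_cubic`, `exists_coneTip_of_isLittleO_cubic` — abstract cone-tip lemmas: if
  `D(x) = Q(x − x₀) + o(‖x − x₀‖³)` for a continuous cubic-homogeneous `Q` with `Q z₀ ≠ 0`, then on every closed cone
  `{c‖x − x₀‖³ ≤ |Q(x − x₀)|}` the function `D` has no zero near the tip other than `x₀`, and there is an OPEN `V ⊆ U` with
  `x₀ ∈ closure V` (it contains the segment `x₀ + t z₀`, `0 < t ≪ 1`) on which `D ≠ 0`;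
* ★ `eventually_disc_ne_zero_of_cone`, ★★ `exists_coneTip_disc_ne_zero` — the same for the discriminant of `inviscidKinematicRigidity`
  at a stagnation centre whose gradient `A = Du(x₀)` commutes with NO rotation generator (E3 `linDisc_ne_zero_or_axisymmetric` BY
  NAME supplies the direction `z₀` with `D_A(z₀) ≠ 0`);
* `frozen_eq_zero_of_disc_ne_zero` (`inviscidKinematicRigidity` BY NAME on an open set where `D ≠ 0` — the density hypothesis is
  trivial there), `frozen_eq_zero_of_mem_closure` (continuity across `closure V`);
* ★★★ `inviscidJetRigidity_stagnation_smooth` — **for a SMOOTH steady drift `u` on an open `U ∋ x₀` with `u x₀ = 0` whose gradient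
  `Du(x₀)` commutes with no rotation generator `z ↦ w × z` (`w ≠ 0`), there is an open cone tip `V ⊆ U` with `x₀ ∈ closure V` such
  that EVERY smooth field `B` frozen into `u` on `I × U` (`I` open: `∂ₜB + DB[u] − Du[B] = 0`) and tangent to the spheres about `x₀`
  vanishes on `I × V`, on `I × (U ∩ closure V)`, and in particular AT THE CENTRE: `B t x₀ = 0` for all `t ∈ I`**
  (`frozen_eq_zero_at_stagnation`) — the smooth counterpart of E6b's `inviscidJetRigidity_stagnation`;
* ★★ `steadyEuler_curl_eq_zero_coneTip_of_stagnation` — a SMOOTH steady incompressible Euler pair `(v, p)` on `U` whose vortex lines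
  are tangent to the spheres about a STAGNATION point `x₀` with non-axisymmetric `Dv(x₀)` is IRROTATIONAL on such a cone tip and
  `curl v (x₀) = 0` (`vorticity_frozen` / `contDiffOn_curl_uncurry` BY NAME; E6b's `steadyEuler_curl_eq_zero_of_stagnation` gives
  `curl v ≡ 0` on `U` for real-analytic `v`).

SHARPNESS (cited, not restated): for axisymmetric `A` the test fails already for the analytic drift `A(x − x₀)`, which carries the
frozen sphere-tangent field `w × (x − x₀) ≢ 0` (E3 `inviscidLinearFlow_dichotomy`).

HONEST FRAME: LOCAL (cone-tip) statements about the INVISCID shadow (frozen-field equation) in a prescribed SMOOTH steady drift and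
about unthreaded smooth steady EULER flows near a stagnation point; information-grade helper under ⟨1222⟩; says nothing about NS;
`PoloidalLiouville` (1222) / `UnthreadedRigidity` (27585) OPEN; NS regularity NOT proved.
-/

-- the summit and its single problem share the name (D-0017 nested layout)
set_option linter.dupNamespace false

noncomputable section

namespace Summit.NavierStokesRegularity.NavierStokesRegularity.Theorems.PoloidalLiouville.ErtelTower

open Set Function Filter Metric Topology Asymptotics
open scoped Topology RealInnerProductSpace InnerProductSpace ContDiff
open Literature.Analysis.FluidPDE
open Summit.NavierStokesRegularity.NavierStokesRegularity.Theorems.PoloidalLiouville.HorizonTower (E3)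

/-! ### Abstract cone-tip lemmas -/

section ConeTip

variable {x₀ : E3} {U : Set E3}

/-- **No zero of `D` near the tip of a closed cone where the cubic beats the remainder.**  If `D(x) = Q(x − x₀) + o(‖x − x₀‖³)`
at `x₀`, then for every `c > 0`: for `x` near `x₀`, `x ≠ x₀` and `c‖x − x₀‖³ ≤ |Q(x − x₀)|` imply `D x ≠ 0`. -/
theorem eventually_ne_zero_of_isLittleO_cubic (D Q : E3 → ℝ)
    (hDQ : (fun x : E3 => D x - Q (x - x₀)) =o[𝓝 x₀] fun x => ‖x - x₀‖ ^ 3) {c : ℝ} (hc : 0 < c) :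
    ∀ᶠ x in 𝓝 x₀, c * ‖x - x₀‖ ^ 3 ≤ |Q (x - x₀)| → x ≠ x₀ → D x ≠ 0 := by
  filter_upwards [hDQ.def (half_pos hc)] with x hx hcone hne hD
  rw [hD, zero_sub, norm_neg, Real.norm_eq_abs, Real.norm_of_nonneg (by positivity)] at hx
  have hpos : 0 < ‖x - x₀‖ ^ 3 := pow_pos (norm_pos_iff.mpr (sub_ne_zero.mpr hne)) 3
  have hpos' : 0 < c * ‖x - x₀‖ ^ 3 := mul_pos hc hpos
  have hx' : |Q (x - x₀)| ≤ c * ‖x - x₀‖ ^ 3 / 2 := by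
    rw [show c * ‖x - x₀‖ ^ 3 / 2 = c / 2 * ‖x - x₀‖ ^ 3 by ring]
    exact hx
  linarith

/-- **Abstract cone tip.**  Let `D(x) = Q(x − x₀) + o(‖x − x₀‖³)` at a point `x₀` of the open `U`, with `Q` continuous,
cubic-homogeneous (`Q(t z) = t³ Q z`) and `Q z₀ ≠ 0` for some `z₀`.  Then there is an OPEN `V ⊆ U` with `x₀ ∈ closure V` on which
`D ≠ 0` — namely `U ∩ B(x₀, r) ∩ {c‖x − x₀‖³ < |Q(x − x₀)|}` with `c = |Q z₀| / (2‖z₀‖³)`, which contains the segment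
`x₀ + t z₀`, `0 < t ≪ 1`. -/
theorem exists_coneTip_of_isLittleO_cubic (D Q : E3 → ℝ) (hU : IsOpen U) (hx₀ : x₀ ∈ U)
    (hDQ : (fun x : E3 => D x - Q (x - x₀)) =o[𝓝 x₀] fun x => ‖x - x₀‖ ^ 3)
    (hQc : Continuous Q) (hhom : ∀ (t : ℝ) (z : E3), Q (t • z) = t ^ 3 * Q z) {z₀ : E3} (hz₀ : Q z₀ ≠ 0) :
    ∃ V : Set E3, IsOpen V ∧ V ⊆ U ∧ x₀ ∈ closure V ∧ ∀ x ∈ V, D x ≠ 0 := by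
  -- `Q 0 = 0`, so `z₀ ≠ 0`
  have hQ0 : Q 0 = 0 := by
    have h := hhom 0 z₀
    rw [zero_smul] at h
    simpa using h
  have hz₀ne : z₀ ≠ 0 := fun h => hz₀ (by rw [h, hQ0])
  have hq : 0 < |Q z₀| := abs_pos.mpr hz₀
  have hn : 0 < ‖z₀‖ := norm_pos_iff.mpr hz₀ne
  -- the cone constant
  set c : ℝ := |Q z₀| / (2 * ‖z₀‖ ^ 3) with hc
  have hcpos : 0 < c := by positivity
  have hcn : c * ‖z₀‖ ^ 3 = |Q z₀| / 2 := by
    rw [hc]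
    field_simp
  -- the radius
  obtain ⟨r, hr, hball⟩ := Metric.eventually_nhds_iff_ball.mp (eventually_ne_zero_of_isLittleO_cubic D Q hDQ hcpos)
  refine ⟨U ∩ Metric.ball x₀ r ∩ {x | c * ‖x - x₀‖ ^ 3 < |Q (x - x₀)|}, ?_, ?_, ?_, ?_⟩
  · -- open
    refine (hU.inter Metric.isOpen_ball).inter (isOpen_lt (by fun_prop) ?_)
    exact continuous_abs.comp (hQc.comp (continuous_id.sub continuous_const))
  · exact fun x hx => hx.1.1
  · -- `x₀` is in the closure: the segment `x₀ + t z₀`, `t → 0⁺`, lies in `V`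
    have hray : Tendsto (fun t : ℝ => x₀ + t • z₀) (𝓝[>] 0) (𝓝 x₀) :=
      (tendsto_ray x₀ z₀).mono_left nhdsWithin_le_nhds
    refine mem_closure_of_tendsto hray ?_
    have hnear : ∀ᶠ t : ℝ in 𝓝[>] 0, x₀ + t • z₀ ∈ U ∩ Metric.ball x₀ r :=
      hray ((hU.inter Metric.isOpen_ball).mem_nhds ⟨hx₀, Metric.mem_ball_self hr⟩)
    have hpos : ∀ᶠ t : ℝ in 𝓝[>] 0, 0 < t := eventually_nhdsWithin_of_forall fun t ht => ht
    filter_upwards [hnear, hpos] with t ht htpos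
    refine ⟨ht, ?_⟩
    show c * ‖x₀ + t • z₀ - x₀‖ ^ 3 < |Q (x₀ + t • z₀ - x₀)|
    rw [add_sub_cancel_left, hhom, norm_smul, Real.norm_of_nonneg htpos.le, mul_pow, abs_mul,
      abs_of_nonneg (pow_nonneg htpos.le 3), mul_left_comm, hcn]
    have ht3 : 0 < t ^ 3 := pow_pos htpos 3
    nlinarith
  · -- `D ≠ 0` on `V`
    rintro x ⟨⟨hxU, hxball⟩, hxcone⟩
    have hne : x ≠ x₀ := by
      intro hxx
      have h' : c * ‖x - x₀‖ ^ 3 < |Q (x - x₀)| := hxcone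
      rw [hxx, sub_self, norm_zero, hQ0] at h'
      simp at h'
    exact hball x hxball (le_of_lt hxcone) hne

end ConeTip

/-! ### The cone tip of the discriminant at a non-axisymmetric stagnation centre -/

section DiscConeTip

variable {u : E3 → E3} {U : Set E3} {x₀ : E3}

/-- ★ **On every closed cone where the cubic `D_A` beats `c > 0`, the discriminant has rank two near the tip**: for a smooth
steady drift with `u x₀ = 0`, `A = Du(x₀)`, and every `c > 0`, for `x` near `x₀` with `x ≠ x₀` and
`c‖x − x₀‖³ ≤ |D_A(x − x₀)|` one has `⟪x − x₀, ∇θ₁(x) × ∇θ₂(x)⟫ ≠ 0`. -/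
theorem eventually_disc_ne_zero_of_cone (hU : IsOpen U) (hu : ContDiffOn ℝ (⊤ : ℕ∞) u U) (hx₀ : x₀ ∈ U)
    (hstag : u x₀ = 0) {c : ℝ} (hc : 0 < c) :
    ∀ᶠ x in 𝓝 x₀,
      c * ‖x - x₀‖ ^ 3 ≤ |⟪x - x₀, cross (ContinuousLinearMap.adjoint (fderiv ℝ u x₀) (x - x₀) + fderiv ℝ u x₀ (x - x₀))
        (ContinuousLinearMap.adjoint (fderiv ℝ u x₀) (ContinuousLinearMap.adjoint (fderiv ℝ u x₀) (x - x₀))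
          + fderiv ℝ u x₀ (fderiv ℝ u x₀ (x - x₀))
          + (2 : ℝ) • ContinuousLinearMap.adjoint (fderiv ℝ u x₀) (fderiv ℝ u x₀ (x - x₀)))⟫| →
      x ≠ x₀ →
      ⟪x - x₀, cross (gradient (radialJerk (fun _ : ℝ => u) x₀ 1 0) x)
        (gradient (radialJerk (fun _ : ℝ => u) x₀ 2 0) x)⟫ ≠ 0 :=
  eventually_ne_zero_of_isLittleO_cubic
    (fun x : E3 => ⟪x - x₀, cross (gradient (radialJerk (fun _ : ℝ => u) x₀ 1 0) x)
      (gradient (radialJerk (fun _ : ℝ => u) x₀ 2 0) x)⟫)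
    (fun z : E3 => ⟪z, cross (ContinuousLinearMap.adjoint (fderiv ℝ u x₀) z + fderiv ℝ u x₀ z)
      (ContinuousLinearMap.adjoint (fderiv ℝ u x₀) (ContinuousLinearMap.adjoint (fderiv ℝ u x₀) z)
        + fderiv ℝ u x₀ (fderiv ℝ u x₀ z)
        + (2 : ℝ) • ContinuousLinearMap.adjoint (fderiv ℝ u x₀) (fderiv ℝ u x₀ z))⟫)
    (isLittleO_disc_stagnation hU hu hx₀ hstag) hc

/-- ★★ **THE CONE TIP OF THE DISCRIMINANT (smooth drift, non-axisymmetric stagnation 1-jet).**  Let `u` be smooth on an open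
`U ∋ x₀` with `u x₀ = 0`, and suppose `A = Du(x₀)` commutes with NO rotation generator `z ↦ w × z` (`w ≠ 0`).  Then there is an
OPEN set `V ⊆ U` with `x₀ ∈ closure V` on which the discriminant `⟪x − x₀, ∇θ₁(x) × ∇θ₂(x)⟫` of `inviscidKinematicRigidity`
vanishes NOWHERE.  (E3 `linDisc_ne_zero_or_axisymmetric` BY NAME gives a direction `z₀` with `D_A(z₀) ≠ 0`; then
`exists_coneTip_of_isLittleO_cubic` with `isLittleO_disc_stagnation`.) -/
theorem exists_coneTip_disc_ne_zero (hU : IsOpen U) (hu : ContDiffOn ℝ (⊤ : ℕ∞) u U) (hx₀ : x₀ ∈ U) (hstag : u x₀ = 0)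
    (hA : ¬ ∃ w : E3, w ≠ 0 ∧ ∀ z : E3, fderiv ℝ u x₀ (cross w z) = cross w (fderiv ℝ u x₀ z)) :
    ∃ V : Set E3, IsOpen V ∧ V ⊆ U ∧ x₀ ∈ closure V ∧
      ∀ x ∈ V, ⟪x - x₀, cross (gradient (radialJerk (fun _ : ℝ => u) x₀ 1 0) x)
        (gradient (radialJerk (fun _ : ℝ => u) x₀ 2 0) x)⟫ ≠ 0 := by
  -- a direction where the cubic is non-zero (E3)
  obtain ⟨z₀, hz₀⟩ : ∃ z₀ : E3, ⟪z₀, cross (ContinuousLinearMap.adjoint (fderiv ℝ u x₀) z₀ + fderiv ℝ u x₀ z₀)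
      (ContinuousLinearMap.adjoint (fderiv ℝ u x₀) (ContinuousLinearMap.adjoint (fderiv ℝ u x₀) z₀)
        + fderiv ℝ u x₀ (fderiv ℝ u x₀ z₀)
        + (2 : ℝ) • ContinuousLinearMap.adjoint (fderiv ℝ u x₀) (fderiv ℝ u x₀ z₀))⟫ ≠ 0 := by
    rcases linDisc_ne_zero_or_axisymmetric (fderiv ℝ u x₀) with ⟨v, hv⟩ | hax
    · exact ⟨v, by rwa [jetCubic_eq] at hv⟩
    · exact absurd hax hA
  exact exists_coneTip_of_isLittleO_cubic
    (fun x : E3 => ⟪x - x₀, cross (gradient (radialJerk (fun _ : ℝ => u) x₀ 1 0) x)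
      (gradient (radialJerk (fun _ : ℝ => u) x₀ 2 0) x)⟫)
    (fun z : E3 => ⟪z, cross (ContinuousLinearMap.adjoint (fderiv ℝ u x₀) z + fderiv ℝ u x₀ z)
      (ContinuousLinearMap.adjoint (fderiv ℝ u x₀) (ContinuousLinearMap.adjoint (fderiv ℝ u x₀) z)
        + fderiv ℝ u x₀ (fderiv ℝ u x₀ z)
        + (2 : ℝ) • ContinuousLinearMap.adjoint (fderiv ℝ u x₀) (fderiv ℝ u x₀ z))⟫)
    hU hx₀ (isLittleO_disc_stagnation hU hu hx₀ hstag) (continuous_jetCubic (fderiv ℝ u x₀))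
    (jetCubic_smul (fderiv ℝ u x₀)) hz₀

end DiscConeTip

/-! ### Rigidity on the cone tip -/

section Rigidity

variable {u : E3 → E3} {U V : Set E3} {x₀ : E3}

/-- **`inviscidKinematicRigidity` on an open set where the discriminant vanishes nowhere.**  If `u` is smooth on the open `U`,
`V ⊆ U` is open and `⟪x − x₀, ∇θ₁ × ∇θ₂⟫ ≠ 0` on `V`, then every smooth field frozen into `u` on `I × U` and tangent to the
spheres about `x₀` vanishes on `I × V` (the density hypothesis of `inviscidKinematicRigidity` holds trivially on `V`). -/
theorem frozen_eq_zero_of_disc_ne_zero (hu : ContDiffOn ℝ (⊤ : ℕ∞) u U) (hV : IsOpen V) (hVU : V ⊆ U)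
    (hD : ∀ x ∈ V, ⟪x - x₀, cross (gradient (radialJerk (fun _ : ℝ => u) x₀ 1 0) x)
      (gradient (radialJerk (fun _ : ℝ => u) x₀ 2 0) x)⟫ ≠ 0)
    (B : ℝ → E3 → E3) (I : Set ℝ) (hI : IsOpen I) (hB : ContDiffOn ℝ (⊤ : ℕ∞) (uncurry B) (I ×ˢ U))
    (hfrozen : ∀ t ∈ I, ∀ x ∈ U, deriv (fun s => B s x) t + fderiv ℝ (B t) x (u x) - fderiv ℝ u x (B t x) = 0)
    (htan : ∀ t ∈ I, ∀ x ∈ U, ⟪B t x, x - x₀⟫ = 0) :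
    ∀ t ∈ I, ∀ x ∈ V, B t x = 0 := by
  have hu' : ContDiffOn ℝ (⊤ : ℕ∞) (uncurry fun (_ : ℝ) (z : E3) => u z) (I ×ˢ V) :=
    (hu.mono hVU).comp contDiffOn_snd fun p hp => hp.2
  have hB' : ContDiffOn ℝ (⊤ : ℕ∞) (uncurry B) (I ×ˢ V) := hB.mono (prod_mono Subset.rfl hVU)
  refine inviscidKinematicRigidity (fun _ : ℝ => u) B x₀ I V hI hV hu' hB'
    (fun t ht x hx => hfrozen t ht x (hVU hx)) (fun t ht x hx => htan t ht x (hVU hx)) fun t _ x hx => ?_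
  refine subset_closure ⟨hx, ?_⟩
  rw [radialJerk_steady u x₀ 1 t 0, radialJerk_steady u x₀ 2 t 0]
  exact hD x hx

/-- **Continuity across the closure.**  A field smooth on `I × U` that vanishes on `I × V`, `V ⊆ U`, vanishes on
`I × (U ∩ closure V)`. -/
theorem frozen_eq_zero_of_mem_closure {B : ℝ → E3 → E3} {I : Set ℝ} (hI : IsOpen I) (hU : IsOpen U)
    (hB : ContDiffOn ℝ (⊤ : ℕ∞) (uncurry B) (I ×ˢ U)) (hVU : V ⊆ U) (hzero : ∀ t ∈ I, ∀ x ∈ V, B t x = 0)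
    {t : ℝ} (ht : t ∈ I) {x : E3} (hx : x ∈ U) (hxV : x ∈ closure V) : B t x = 0 := by
  have hcont : ContinuousWithinAt (B t) V x := ((continuousOn_space hB hI hU ht).continuousWithinAt hx).mono hVU
  have hmem : B t x ∈ closure (B t '' V) := hcont.mem_closure_image hxV
  have hsub : B t '' V ⊆ {0} := by
    rintro _ ⟨y, hy, rfl⟩
    exact hzero t ht y hy
  have h := closure_mono hsub hmem
  rwa [closure_singleton, mem_singleton_iff] at h

/-- ★★★ **CONE-TIP RIGIDITY AT A STAGNATION CENTRE (SMOOTH steady drift).**  Let `u` be smooth on an open `U ∋ x₀` with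
`u x₀ = 0`, and suppose the velocity gradient `A = Du(x₀)` commutes with NO rotation generator `z ↦ w × z`, `w ≠ 0` (the
linear flow `A z` is not axisymmetric about any axis through the centre).  Then there is an OPEN set `V ⊆ U` with
`x₀ ∈ closure V` (a cone tip at `x₀`, `exists_coneTip_disc_ne_zero`) such that EVERY smooth field `B` frozen into `u` on
`I × U` (`I` open: `∂ₜB + DB[u] − Du[B] = 0`) and tangent to the spheres about `x₀`
(i) vanishes on `I × V`, (ii) vanishes on `I × (U ∩ closure V)`, and (iii) in particular VANISHES AT THE CENTRE: `B t x₀ = 0`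
for all `t ∈ I`.
(Regularity used: `u` of class `C²` near `x₀` for the cone tip, smoothness only through `inviscidKinematicRigidity`'s
convention `ContDiffOn ℝ ⊤`.)
The smooth counterpart of E6b's `inviscidJetRigidity_stagnation` (real-analytic drift ⇒ `B ≡ 0` on all of `I × U`); for axisymmetric
`A` even (iii) fails (`inviscidLinearFlow_dichotomy`, E3: `w × (x − x₀)` is frozen into `A(x − x₀)` — but there `B(x₀) = 0` too,
so the content of the theorem is (i)). -/
theorem inviscidJetRigidity_stagnation_smooth (u : E3 → E3) (x₀ : E3) (U : Set E3) (hU : IsOpen U) (hx₀ : x₀ ∈ U)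
    (hu : ContDiffOn ℝ (⊤ : ℕ∞) u U) (hstag : u x₀ = 0)
    (hA : ¬ ∃ w : E3, w ≠ 0 ∧ ∀ z : E3, fderiv ℝ u x₀ (cross w z) = cross w (fderiv ℝ u x₀ z)) :
    ∃ V : Set E3, IsOpen V ∧ V ⊆ U ∧ x₀ ∈ closure V ∧
      ∀ (B : ℝ → E3 → E3) (I : Set ℝ), IsOpen I → ContDiffOn ℝ (⊤ : ℕ∞) (uncurry B) (I ×ˢ U) →
        (∀ t ∈ I, ∀ x ∈ U, deriv (fun s => B s x) t + fderiv ℝ (B t) x (u x) - fderiv ℝ u x (B t x) = 0) →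
        (∀ t ∈ I, ∀ x ∈ U, ⟪B t x, x - x₀⟫ = 0) →
        (∀ t ∈ I, ∀ x ∈ V, B t x = 0) ∧ (∀ t ∈ I, ∀ x ∈ U, x ∈ closure V → B t x = 0) ∧ ∀ t ∈ I, B t x₀ = 0 := by
  obtain ⟨V, hV, hVU, hx₀V, hD⟩ := exists_coneTip_disc_ne_zero hU hu hx₀ hstag hA
  refine ⟨V, hV, hVU, hx₀V, fun B I hI hB hfrozen htan => ?_⟩
  have hzero : ∀ t ∈ I, ∀ x ∈ V, B t x = 0 :=
    frozen_eq_zero_of_disc_ne_zero hu hV hVU hD B I hI hB hfrozen htan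
  exact ⟨hzero, fun t ht x hx hxV => frozen_eq_zero_of_mem_closure hI hU hB hVU hzero ht hx hxV,
    fun t ht => frozen_eq_zero_of_mem_closure hI hU hB hVU hzero ht hx₀ hx₀V⟩

/-- ★★ **Corollary: the frozen field vanishes at a non-axisymmetric stagnation centre** (smooth drift). -/
theorem frozen_eq_zero_at_stagnation (u : E3 → E3) (x₀ : E3) (U : Set E3) (hU : IsOpen U) (hx₀ : x₀ ∈ U)
    (hu : ContDiffOn ℝ (⊤ : ℕ∞) u U) (hstag : u x₀ = 0)
    (hA : ¬ ∃ w : E3, w ≠ 0 ∧ ∀ z : E3, fderiv ℝ u x₀ (cross w z) = cross w (fderiv ℝ u x₀ z))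
    (B : ℝ → E3 → E3) (I : Set ℝ) (hI : IsOpen I) (hB : ContDiffOn ℝ (⊤ : ℕ∞) (uncurry B) (I ×ˢ U))
    (hfrozen : ∀ t ∈ I, ∀ x ∈ U, deriv (fun s => B s x) t + fderiv ℝ (B t) x (u x) - fderiv ℝ u x (B t x) = 0)
    (htan : ∀ t ∈ I, ∀ x ∈ U, ⟪B t x, x - x₀⟫ = 0) :
    ∀ t ∈ I, B t x₀ = 0 := by
  obtain ⟨V, -, -, -, hVB⟩ := inviscidJetRigidity_stagnation_smooth u x₀ U hU hx₀ hu hstag hA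
  exact (hVB B I hI hB hfrozen htan).2.2

end Rigidity

/-! ### Smooth steady Euler flows -/

section SteadyEuler

/-- ★★ **CONE-TIP IRROTATIONALITY OF UNTHREADED SMOOTH STEADY EULER FLOWS AT A STAGNATION POINT.**  Let `(v, p)` be a SMOOTH
steady incompressible Euler pair on an open `U` (`Dv[v] + ∇p = 0`, `div v = 0`) whose vortex lines are tangent to the spheres
about `x₀ ∈ U` (`⟪curl v, x − x₀⟫ = 0` on `U`).  If `x₀` is a stagnation point (`v x₀ = 0`) whose velocity gradient `Dv(x₀)`
commutes with no rotation generator, then there is an open cone tip `V ⊆ U`, `x₀ ∈ closure V`, on which `v` is IRROTATIONAL, and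
`curl v (x₀) = 0`.  (The vorticity is frozen into `v`: `vorticity_frozen`; then `inviscidJetRigidity_stagnation_smooth`.)
E6b's `steadyEuler_curl_eq_zero_of_stagnation` gives `curl v ≡ 0` on all of `U` when `v` is real-analytic. -/
theorem steadyEuler_curl_eq_zero_coneTip_of_stagnation (v : E3 → E3) (p : E3 → ℝ) (x₀ : E3) (U : Set E3)
    (hU : IsOpen U) (hx₀ : x₀ ∈ U) (hv : ContDiffOn ℝ (⊤ : ℕ∞) v U) (hp : ContDiffOn ℝ (⊤ : ℕ∞) p U)
    (heuler : ∀ x ∈ U, fderiv ℝ v x (v x) + gradient p x = 0)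
    (hdiv : ∀ x ∈ U, Literature.Analysis.FluidPDE.VectorCalculus.divergence v x = 0)
    (hunthr : ∀ x ∈ U, ⟪curl v x, x - x₀⟫ = 0) (hstag : v x₀ = 0)
    (hA : ¬ ∃ w : E3, w ≠ 0 ∧ ∀ z : E3, fderiv ℝ v x₀ (cross w z) = cross w (fderiv ℝ v x₀ z)) :
    ∃ V : Set E3, IsOpen V ∧ V ⊆ U ∧ x₀ ∈ closure V ∧ (∀ x ∈ V, curl v x = 0) ∧ curl v x₀ = 0 := by
  obtain ⟨V, hV, hVU, hx₀V, hVB⟩ := inviscidJetRigidity_stagnation_smooth v x₀ U hU hx₀ hv hstag hA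
  -- the steady pair read on `univ × U`
  have hv' : ContDiffOn ℝ (⊤ : ℕ∞) (uncurry fun (_ : ℝ) (z : E3) => v z) ((univ : Set ℝ) ×ˢ U) :=
    hv.comp contDiffOn_snd fun q hq => hq.2
  have hp' : ContDiffOn ℝ (⊤ : ℕ∞) (uncurry fun (_ : ℝ) (z : E3) => p z) ((univ : Set ℝ) ×ˢ U) :=
    hp.comp contDiffOn_snd fun q hq => hq.2
  have heuler' : ∀ t ∈ (univ : Set ℝ), ∀ x ∈ U,
      deriv (fun _ : ℝ => v x) t + fderiv ℝ v x (v x) + gradient p x = 0 := by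
    intro t _ x hx
    rw [deriv_const, zero_add]
    exact heuler x hx
  have hB : ContDiffOn ℝ (⊤ : ℕ∞) (uncurry fun (t : ℝ) (x : E3) => curl ((fun _ : ℝ => v) t) x) ((univ : Set ℝ) ×ˢ U) :=
    contDiffOn_curl_uncurry hv' isOpen_univ hU
  have hfrozen := vorticity_frozen (v := fun _ : ℝ => v) (p := fun _ : ℝ => p) isOpen_univ hU hv' hp' heuler'
    (fun _ _ y hy => hdiv y hy)
  obtain ⟨hzero, -, hcentre⟩ := hVB (fun (_ : ℝ) (x : E3) => curl v x) univ isOpen_univ hB hfrozen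
    (fun _ _ y hy => hunthr y hy)
  exact ⟨V, hV, hVU, hx₀V, fun x hx => hzero 0 (mem_univ _) x hx, hcentre 0 (mem_univ _)⟩

end SteadyEuler

end Summit.NavierStokesRegularity.NavierStokesRegularity.Theorems.PoloidalLiouville.ErtelTower

end
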